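/-
Copyright (c) 2026 the pub-hodgecm-mathlib formalisation cell (harness21).  Prover seat hodgecm-mathlib-K2Liu-p25 (g3), Track B «K2-LIT»,
#184♮ = hLiu418 = `stmt-HodgeConjecture-24832`; #42S BLOCK D, row D-2, algebraic road of record (block-D desk K2Liu-p12 (g5) WORD #3, ★ p863715):
THE (1+1) LINE-MODEL INSTANTIATION of its by-value local model letters, with the fibre letter DISCHARGED (LEAD F0P6-plan (g15) BATCH #204, re-aim (A′)).
THEOREMS ONLY (no `def`, no `instance`, no `notation`, no named-fact hypothesis, no `sorry`, default heartbeats).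
-/
import Summits.HodgeConjecture.HodgeConjecture.Theorems.K2LiuIncoherentRankOneBadPlaceFunctionalRow   -- ★ p863715: `hbad_faces_of_lineFunctional` (algebraic road, model BY VALUE)
import Summits.HodgeConjecture.HodgeConjecture.Theorems.K2LiuIncoherentRankOneBadPlaceDichotomy      -- ★ p863790: the (1+1) phase form and its Ψ-free dichotomy
import Literature.RepresentationTheory.HeisenbergGroup.SchrodingerPiOperators                         -- ★ Rao: `unipOpPi`, `coe_unipOpPi_apply`, `continuous_halfForm`
import HarnessLib

-- buildfix G11b-3 recipe (LEDGER B13-1/B13-3), as in the GelbartRogawski1991 siblings: elaborate sequentially.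
set_option Elab.async false

/-!
# Crux `HLiu418`, #42S BLOCK D, row D-2 (algebraic road ★ p863715): THE (1+1) LINE MODEL — Rao multiplier operators on `𝒮(L⁺_v^{1+1})`, phase `−halfForm(c_τ)`,
# fibre letter discharged by ★ p863790; by-value residue = the SEAM proper `(Λ, hΛ, Φ, hWfun)` + the Whittaker class `hclass`

Cell `hodgecm-mathlib`, crux item hLiu418 = `stmt-HodgeConjecture-24832` (helper lane `--supports … --as helper`, count-neutral; closes no socket); squad K2 ∕ K2Liu (L1).
Prover K2Liu-p25 (g3); block-D desk K2Liu-p12 (g5); K1a desk K2E5-p16 (g8); LEAD F0P6-plan (g15) BATCH #204; box K2Liu-audit1 (g3).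

★ p863715 `K2LiuIncoherentRankOneBadPlaceFunctionalRow.hbad_faces_of_lineFunctional` takes the LOCAL MODEL at each bad place BY VALUE: a space `Xsp v`, a group `Zg v`,
a representation `ρ X v` of `Zg v` on `𝒮(Xsp v)` acting by multipliers `ψ_v(bz z · Gm x)` (`hρ`, `hu`, `bz` onto), the Whittaker parameter `β′ X v` with its character
`χq X v` (`hχ`), and the fibre letter `hfibre : dead ⇒ ∀ x, Gm X v x ≠ β′ X v`.  THIS FILE INSTANTIATES THEM on the doubled LINE in the rank-`1 + 1` Schrödinger model
of ★ p863790 §3–§4: `Xsp v := L⁺_v^{1+1}`, `Zg v := Multiplicative L⁺_v`, `ρ X v z := unipOpPi (z • c_τ(X, v))` — Rao's unipotent multiplier operator of the Siegel unipotent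
`n(z·τ_X)` of `U(⟨a_v⟩ ⊕ ⟨−a_v⟩)` read through ANY `E″_v ∈ Sp(𝕎_v)`, `c_τ(X, v) := cOfFix 𝕋_v (E″_v · ι(n(τ_X·1)) · E″_v⁻¹)` —, `bz := toAdd`, `Gm X v := −halfForm(c_τ(X,v))`
(the operator's own phase, ★ `coe_unipOpPi_apply`), `χq X v := ψ_v(· β′ X v)`; and DISCHARGES `hfibre` by ★ p863790
`halfForm_cOfFix_mover_conj_nElem_ne_of_hilbertSymbol_cmQuadraticGenerator` from ONE class letter
`hclass : dead ⇒ ((−β′ X v)·(a_v·im τ_X)⁻¹, θ)_v = −1` (the (o1) normalisation «Whittaker parameter over phase scale ≡ `val X · a_v⁻¹` mod norms» + the line's class;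
§1 `hilbertSymbol_eq_neg_one_of_dead` is the one-liner the constructor closes it with).
* §1 `halfForm_smul_left` (`halfForm (z • c) x = z · halfForm c x`), `hilbertSymbol_eq_neg_one_of_dead` (deadness + line class + norm congruence ⇒ class `−1`; ★ bilinearity
  `hilbertSymbol_adicCompletion_mul_left`).
* §2 **`hbad_faces_of_lineModel`** — ★ p863715's conclusion (the `hbad` binder of ★ p863475 BYTES) from: the frame letters `S₁ val I Tf W cW`, the (1+1) datum per place
  `T (hTs) τ (hτ) E″`, the parameter `β′` (`hβ : β′ ≠ 0`), the class letter `hclass`, and the SEAM PROPER: functionals `Λ X j h i v : 𝒮(L⁺_v^{1+1}) →ₗ ℂ` with CONCRETE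
  quasi-invariance `hΛ : Λ (unipOpPi (z • c_τ) φ) = ψ_v(z·β′)·Λ φ`, vectors `Φ X j h i v`, presentation `hWfun : W = cW · Λ(Φ)`.  By-value residue of D-2 on this road =
  `{hclass} ∪ {Λ, hΛ, Φ, hWfun}` — the latter is (σ-A)+(σ-B) of LH4-p11's census («the continued bad factor is Karel's regularised Whittaker functional of the LINE vector
  `Ψ(Φ_v)`»), nothing else.
[KudlaRallis1994, §2–§3] [Rallis1984, §4] [Rangarao1993, Lemma 3.2 (3.8)] [MoeglinVignerasWaldspurger1987, Chap. 2 II.6, Chap. 3 IV] [Omeara1963, §63B].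
HONEST LABEL.  Model plumbing + one Hilbert-symbol line; count-neutral helper; `HC_CM` is proved only modulo the 7 printed citations (2 remaining named inputs:
hLiu418 = `stmt-HodgeConjecture-24832`, h413 = `stmt-HodgeConjecture-24833`) until rung 0 closes.  NOT here: `hWfun` ((σ-A)+(σ-B), SW lineage) and `hclass`'s (o1) congruence.

## References
* [KudlaRallis1994] S. Kudla, S. Rallis, Ann. of Math. 140 (1994), §2–§3.
* [Rallis1984] S. Rallis, *On the Howe duality conjecture*, Compositio Math. 51 (1984), §4.
* [Rangarao1993] R. Ranga Rao, Pacific J. Math. 157 (1993), Lemma 3.2 (3.8) p. 351.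
* [MoeglinVignerasWaldspurger1987] C. Mœglin, M.-F. Vignéras, J.-L. Waldspurger, LNM 1291 (1987), Chap. 2 II.6; Chap. 3 §IV.
* [Omeara1963] O. T. O'Meara, *Introduction to Quadratic Forms* (1963), §63B.
-/

set_option autoImplicit false
set_option linter.dupNamespace false -- the mandated namespace repeats `HodgeConjecture.HodgeConjecture`

noncomputable section

open scoped Matrix
open NumberField IsDedekindDomain Matrix
open Literature.RepresentationTheory.HeisenbergGroup Literature.RepresentationTheory.HeisenbergGroup.SymplecticMatrix
open Literature.NumberTheory.QuadraticForms Literature.NumberTheory.Automorphic Literature.NumberTheory.Automorphic.UnitaryGroup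
open Literature.NumberTheory.Automorphic.UnitaryGroup.QuadraticCoordinates
open Literature.NumberTheory.GaloisRepresentations Literature.NumberTheory.GaloisRepresentations.IsNonarchimedeanLocalField
open Literature.NumberTheory.GelbartRogawski1991 Literature.NumberTheory.GelbartRogawski1991.GRConstruction
open Literature.NumberTheory.GelbartRogawski1991.UnitaryDualPair Literature.NumberTheory.GelbartRogawski1991.UnitaryDualPair.LocalSplitting
open Literature.NumberTheory.GelbartRogawski1991.AdaptedBlocks

namespace Summit.HodgeConjecture.HodgeConjecture.Cruxes.HLiu418.K2LiuIncoherentRankOneBadPlaceLineModel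

open K2LiuSiegelUnipotentFourierDefs
open K2LiuIncoherentRankOneBadPlaceFunctionalRow (hbad_faces_of_lineFunctional)
open K2LiuIncoherentRankOneBadPlaceDichotomy (halfForm_cOfFix_mover_conj_nElem_ne_of_hilbertSymbol_cmQuadraticGenerator)

/-! ## §1 Two one-liners: scaling of the phase form, and the Whittaker class at a dead place -/

section Lemmas

/-- `halfForm (z • c) x = z · halfForm c x` (the phase of `n(z·τ)` is `z` times the phase of `n(τ)`). [cite: Rangarao1993, Lemma 3.1, p. 351] -/
theorem halfForm_smul_left {F : Type*} [Field F] [Invertible (2 : F)] {ι : Type*} [Fintype ι] (z : F) (c : (ι → F) →ₗ[F] (ι → F)) (x : ι → F) :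
    halfForm (z • c) x = z * halfForm c x := by
  rw [halfForm_apply, halfForm_apply, LinearMap.smul_apply, dotProduct_smul, smul_eq_mul]
  ring

variable (K : Type) [Field K] [NumberField K] (v : HeightOneSpectrum (𝓞 K))

/-- **THE WHITTAKER CLASS AT A DEAD PLACE** (the one-liner closing `hclass`): if `v` is dead for `x` w.r.t. the pattern (`¬((x, θ)_v = −1 ↔ P)`) while the
line datum `a` HAS the pattern's class (`(a, θ)_v = −1 ↔ P`), then every `u` congruent to `x · a⁻¹` modulo a non-zero value `r² − θ s²` has `(u, θ)_v = −1`
(local bimultiplicativity ★ `hilbertSymbol_adicCompletion_mul_left`; `x, a, θ ≠ 0`). [cite: Omeara1963, §63B (formulas after 63:10)] -/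
theorem hilbertSymbol_eq_neg_one_of_dead {x a θ u r s : v.adicCompletion K} (hx : x ≠ 0) (ha : a ≠ 0) (hθ : θ ≠ 0) {P : Prop}
    (hdead : ¬ (hilbertSymbol (v.adicCompletion K) x θ = -1 ↔ P)) (hline : hilbertSymbol (v.adicCompletion K) a θ = -1 ↔ P)
    (hN : r ^ 2 - θ * s ^ 2 ≠ 0) (hu : u = x * a⁻¹ * (r ^ 2 - θ * s ^ 2)) :
    hilbertSymbol (v.adicCompletion K) u θ = -1 := by
  haveI : CharZero (v.adicCompletion K) := charZero_of_injective_algebraMap (algebraMap K (v.adicCompletion K)).injective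
  haveI : NeZero (2 : v.adicCompletion K) := ⟨two_ne_zero⟩
  -- the norm-shaped factor has symbol `1`
  have hnorm : hilbertSymbol (v.adicCompletion K) (r ^ 2 - θ * s ^ 2) θ = 1 := by
    rw [hilbertSymbol_comm]
    exact (hilbertSymbol_eq_one_iff_exists_norm hθ hN).2 ⟨r, s, rfl⟩
  -- `(a⁻¹, θ) = (a, θ)` (square classes)
  have hainv : hilbertSymbol (v.adicCompletion K) a⁻¹ θ = hilbertSymbol (v.adicCompletion K) a θ := by
    rw [show a⁻¹ = a * (a⁻¹) ^ 2 from by field_simp, hilbertSymbol_mul_sq_left _ _ (inv_ne_zero ha)]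
  rw [hu, hilbertSymbol_adicCompletion_mul_left K v (mul_ne_zero hx (inv_ne_zero ha)) hN hθ, hnorm, mul_one,
    hilbertSymbol_adicCompletion_mul_left K v hx (inv_ne_zero ha) hθ, hainv]
  -- `(x, θ) ≠ (a, θ)`, both in `{1, −1}`
  rcases hilbertSymbol_eq_one_or_eq_neg_one x θ with h1 | h1 <;>
    rcases hilbertSymbol_eq_one_or_eq_neg_one a θ with h2 | h2 <;> rw [h1, h2] <;> simp_all

end Lemmas

/-! ## §2 The (1+1) line-model instantiation of ★ p863715's by-value model, fibre letter discharged -/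

section Row

variable (L : Type) [Field L] [NumberField L] [IsCMField L]
variable {N M n : ℕ} (e : Fin N × Fin M ≃ Fin n)
  (dV : Fin N → L) (hdV : ∀ i, IsCMField.complexConj L (dV i) = dV i)
  (dW : Fin M → L) (hdW : ∀ i, IsCMField.complexConj L (dW i) = dW i)

variable {ι : skewMatrices ((IsCMField.complexConj L : L ≃ₐ[Fp L] L) : L →+* L) ((gramR L e dV hdV dW hdW).map (algebraMap (Fp L) L)) → Type}

set_option maxHeartbeats 400000 in
/-- **ROW D-2, ALGEBRAIC ROAD, (1+1) LINE MODEL** — ★ p863715 `hbad_faces_of_lineFunctional`'s conclusion (the `hbad` binder of ★ p863475 BYTES) with its local model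
INSTANTIATED on `𝒮(L⁺_v^{1+1})` by Rao's multiplier operators `unipOpPi (z • c_τ(X,v))` (`c_τ(X,v) = cOfFix 𝕋_v (E″_v ι(n(τ_X v·1)) E″_v⁻¹)`, ANY `E″_v ∈ Sp(𝕎_v)`), phase
`Gm := −halfForm(c_τ)`, `bz := toAdd`, `χq := ψ_v(· β′)`, and the fibre letter DISCHARGED by ★ p863790 from the class letter `hclass` («dead ⇒ `((−β′ X v)·(a_v·im τ_X v)⁻¹, θ)_v = −1`»).
BY VALUE remain: the frame `S₁ val I Tf W cW`, the datum `T τ E″`, the parameter `β′` (`hβ`), `hclass`, and the SEAM PROPER — functionals `Λ` with CONCRETE quasi-invariance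
`hΛ : Λ (unipOpPi (z • c_τ) φ) = ψ_v(z·β′)·Λ φ`, vectors `Φ`, presentation `hWfun : W = cW · Λ(Φ)`. [cite: KudlaRallis1994, §3] [cite: Rallis1984, §4]
[cite: Rangarao1993, Lemma 3.2 (3.8) p. 351] [cite: MoeglinVignerasWaldspurger1987, Chap. 3 IV] -/
theorem hbad_faces_of_lineModel {φ : Type*}
    (S₁ : Finset (HeightOneSpectrum (𝓞 ↥(maximalRealSubfield L))))
    (val : Matrix (Fin n) (Fin n) L → ↥(maximalRealSubfield L))
    (I : ∀ X : skewMatrices ((IsCMField.complexConj L : L ≃ₐ[Fp L] L) : L →+* L) ((gramR L e dV hdV dW hdW).map (algebraMap (Fp L) L)),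
      ι X → HA L e dV hdV dW hdW → Finset φ)
    (Tf : ∀ X : skewMatrices ((IsCMField.complexConj L : L ≃ₐ[Fp L] L) : L →+* L) ((gramR L e dV hdV dW hdW).map (algebraMap (Fp L) L)),
      ι X → HA L e dV hdV dW hdW → Finset (HeightOneSpectrum (𝓞 ↥(maximalRealSubfield L))))
    (W cW : ∀ X : skewMatrices ((IsCMField.complexConj L : L ≃ₐ[Fp L] L) : L →+* L) ((gramR L e dV hdV dW hdW).map (algebraMap (Fp L) L)),
      ι X → HA L e dV hdV dW hdW → φ → HeightOneSpectrum (𝓞 ↥(maximalRealSubfield L)) → ℂ)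
    -- the (1+1) doubled-line datum at each place: Gram `T v = (a_v)`, a symplectic element `E″ v`, the skew parameter `τ X v`
    (T : HeightOneSpectrum (𝓞 ↥(maximalRealSubfield L)) → Matrix (Fin 1) (Fin 1) ↥(maximalRealSubfield L)) (hTs : ∀ v, (T v).IsSymm)
    (E'' : ∀ v : HeightOneSpectrum (𝓞 ↥(maximalRealSubfield L)), LocalSp ↥(maximalRealSubfield L) (1 + 1) (gramD ↥(maximalRealSubfield L) 1 (T v)) v)
    (τ : skewMatrices ((IsCMField.complexConj L : L ≃ₐ[Fp L] L) : L →+* L) ((gramR L e dV hdV dW hdW).map (algebraMap (Fp L) L)) →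
      ∀ v : HeightOneSpectrum (𝓞 ↥(maximalRealSubfield L)), LocalRing L v)
    (hτ : ∀ X v, conjLocal L (IsCMField.complexConj L) v (τ X v) = -τ X v)
    -- the Whittaker parameter and its class at dead places
    (β' : skewMatrices ((IsCMField.complexConj L : L ≃ₐ[Fp L] L) : L →+* L) ((gramR L e dV hdV dW hdW).map (algebraMap (Fp L) L)) →
      ∀ v : HeightOneSpectrum (𝓞 ↥(maximalRealSubfield L)), v.adicCompletion ↥(maximalRealSubfield L))
    (hβ : ∀ X v, β' X v ≠ 0)
    (hclass : ∀ X : skewMatrices ((IsCMField.complexConj L : L ≃ₐ[Fp L] L) : L →+* L) ((gramR L e dV hdV dW hdW).map (algebraMap (Fp L) L)),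
      (X : Matrix (Fin n) (Fin n) L) ≠ 0 → (X : Matrix (Fin n) (Fin n) L).det = 0 → ∀ (j : ι X) (h : HA L e dV hdV dW hdW), ∀ v ∈ Tf X j h,
      ¬ (hilbertSymbol (v.adicCompletion ↥(maximalRealSubfield L)) (algebraMap ↥(maximalRealSubfield L) _ (val X))
          (algebraMap ↥(maximalRealSubfield L) _ (cmQuadraticGenerator L : ↥(maximalRealSubfield L))) = -1 ↔ v ∈ S₁) →
      hilbertSymbol (v.adicCompletion ↥(maximalRealSubfield L))
        (-β' X v * (algebraMap ↥(maximalRealSubfield L) (v.adicCompletion ↥(maximalRealSubfield L)) (T v 0 0) *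
          im (quadraticLocalEquiv L v (IsCMField.complexConj L) (complexConj_imagUnit L) (imagUnit_ne_zero L)).toLinearEquiv.toAddEquiv (τ X v))⁻¹)
        (algebraMap ↥(maximalRealSubfield L) (v.adicCompletion ↥(maximalRealSubfield L)) (cmQuadraticGenerator L : ↥(maximalRealSubfield L))) = -1)
    -- THE SEAM PROPER (BY VALUE): regularised functionals on the line model, their quasi-invariance under Rao's multipliers, the line vectors, the presentation
    (Λ : ∀ X : skewMatrices ((IsCMField.complexConj L : L ≃ₐ[Fp L] L) : L →+* L) ((gramR L e dV hdV dW hdW).map (algebraMap (Fp L) L)),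
      ι X → HA L e dV hdV dW hdW → φ → ∀ v : HeightOneSpectrum (𝓞 ↥(maximalRealSubfield L)),
        ↥(SchwartzBruhat (Fin (1 + 1) → v.adicCompletion ↥(maximalRealSubfield L))) →ₗ[ℂ] ℂ)
    (hΛ : ∀ X j h i v (z : v.adicCompletion ↥(maximalRealSubfield L)) (φ' : ↥(SchwartzBruhat (Fin (1 + 1) → v.adicCompletion ↥(maximalRealSubfield L)))),
      Λ X j h i v (unipOpPi (isLocallyConstant_of_isContinuousNontrivial (isContinuousNontrivial_adeleAddCharAt ↥(maximalRealSubfield L) v))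
        (z • Matrix.mulVecLin (cOfFix (localGram ↥(maximalRealSubfield L) (1 + 1) (gramD ↥(maximalRealSubfield L) 1 (T v)) v)
          (E'' v * iotaD ↥(maximalRealSubfield L) L (IsCMField.complexConj L) (complexConj_imagUnit L) (imagUnit_ne_zero L) (imagUnit_mul_self L) v 1 (hTs v) rfl
            (nElem ↥(maximalRealSubfield L) L (IsCMField.complexConj L) v 1 rfl (τ X v • 1)
              (skew_smul_one ↥(maximalRealSubfield L) L (IsCMField.complexConj L) v 1 (τ X v) (hτ X v))) * (E'' v)⁻¹))) φ') =
        ((adeleAddCharAt ↥(maximalRealSubfield L) v (z * β' X v) : Circle) : ℂ) • Λ X j h i v φ')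
    (Φ : ∀ X : skewMatrices ((IsCMField.complexConj L : L ≃ₐ[Fp L] L) : L →+* L) ((gramR L e dV hdV dW hdW).map (algebraMap (Fp L) L)),
      ι X → HA L e dV hdV dW hdW → φ → ∀ v : HeightOneSpectrum (𝓞 ↥(maximalRealSubfield L)),
        ↥(SchwartzBruhat (Fin (1 + 1) → v.adicCompletion ↥(maximalRealSubfield L))))
    (hWfun : ∀ X : skewMatrices ((IsCMField.complexConj L : L ≃ₐ[Fp L] L) : L →+* L) ((gramR L e dV hdV dW hdW).map (algebraMap (Fp L) L)),
      (X : Matrix (Fin n) (Fin n) L) ≠ 0 → (X : Matrix (Fin n) (Fin n) L).det = 0 → ∀ (j : ι X) (h : HA L e dV hdV dW hdW), ∀ i ∈ I X j h, ∀ v ∈ Tf X j h,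
      W X j h i v = cW X j h i v * Λ X j h i v (Φ X j h i v)) :
    ∀ X : skewMatrices ((IsCMField.complexConj L : L ≃ₐ[Fp L] L) : L →+* L) ((gramR L e dV hdV dW hdW).map (algebraMap (Fp L) L)),
      (X : Matrix (Fin n) (Fin n) L) ≠ 0 → (X : Matrix (Fin n) (Fin n) L).det = 0 → ∀ (j : ι X) (h : HA L e dV hdV dW hdW), ∀ i ∈ I X j h, ∀ v ∈ Tf X j h,
      ¬ (hilbertSymbol (v.adicCompletion ↥(maximalRealSubfield L)) (algebraMap ↥(maximalRealSubfield L) _ (val X))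
          (algebraMap ↥(maximalRealSubfield L) _ (cmQuadraticGenerator L : ↥(maximalRealSubfield L))) = -1 ↔ v ∈ S₁) → W X j h i v = 0 := by
  -- abbreviations: the additive character, the Rao parameter, the phase form
  set ψ : ∀ v : HeightOneSpectrum (𝓞 ↥(maximalRealSubfield L)), AddChar (v.adicCompletion ↥(maximalRealSubfield L)) Circle :=
    fun v => adeleAddCharAt ↥(maximalRealSubfield L) v with hψ
  have hl : ∀ v, IsLocallyConstant (⇑(ψ v) : v.adicCompletion ↥(maximalRealSubfield L) → Circle) :=
    fun v => isLocallyConstant_of_isContinuousNontrivial (isContinuousNontrivial_adeleAddCharAt ↥(maximalRealSubfield L) v)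
  set cτ : ∀ (X : skewMatrices ((IsCMField.complexConj L : L ≃ₐ[Fp L] L) : L →+* L) ((gramR L e dV hdV dW hdW).map (algebraMap (Fp L) L)))
      (v : HeightOneSpectrum (𝓞 ↥(maximalRealSubfield L))),
      (Fin (1 + 1) → v.adicCompletion ↥(maximalRealSubfield L)) →ₗ[v.adicCompletion ↥(maximalRealSubfield L)] (Fin (1 + 1) → v.adicCompletion ↥(maximalRealSubfield L)) :=
    fun X v => Matrix.mulVecLin (cOfFix (localGram ↥(maximalRealSubfield L) (1 + 1) (gramD ↥(maximalRealSubfield L) 1 (T v)) v)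
      (E'' v * iotaD ↥(maximalRealSubfield L) L (IsCMField.complexConj L) (complexConj_imagUnit L) (imagUnit_ne_zero L) (imagUnit_mul_self L) v 1 (hTs v) rfl
        (nElem ↥(maximalRealSubfield L) L (IsCMField.complexConj L) v 1 rfl (τ X v • 1)
          (skew_smul_one ↥(maximalRealSubfield L) L (IsCMField.complexConj L) v 1 (τ X v) (hτ X v))) * (E'' v)⁻¹)) with hcτ
  -- the representation of `Multiplicative L⁺_v` by Rao's multiplier operators `z ↦ unipOpPi (z • c_τ)`
  let ρ : ∀ (X : skewMatrices ((IsCMField.complexConj L : L ≃ₐ[Fp L] L) : L →+* L) ((gramR L e dV hdV dW hdW).map (algebraMap (Fp L) L)))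
      (v : HeightOneSpectrum (𝓞 ↥(maximalRealSubfield L))),
      Representation ℂ (Multiplicative (v.adicCompletion ↥(maximalRealSubfield L))) ↥(SchwartzBruhat (Fin (1 + 1) → v.adicCompletion ↥(maximalRealSubfield L))) :=
    fun X v =>
      { toFun := fun z => ((unipOpPi (hl v) (Multiplicative.toAdd z • cτ X v) :
            ↥(SchwartzBruhat (Fin (1 + 1) → v.adicCompletion ↥(maximalRealSubfield L))) ≃ₗ[ℂ] _) :
            ↥(SchwartzBruhat (Fin (1 + 1) → v.adicCompletion ↥(maximalRealSubfield L))) →ₗ[ℂ] _)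
        map_one' := by
          rw [toAdd_one, zero_smul, unipOpPi_zero]
          rfl
        map_mul' := fun z₁ z₂ => by
          rw [toAdd_mul, add_smul, unipOpPi_add]
          rfl }
  have hρapply : ∀ X v (z : Multiplicative (v.adicCompletion ↥(maximalRealSubfield L)))
      (φ' : ↥(SchwartzBruhat (Fin (1 + 1) → v.adicCompletion ↥(maximalRealSubfield L)))),
      ρ X v z φ' = unipOpPi (hl v) (Multiplicative.toAdd z • cτ X v) φ' := fun _ _ _ _ => rfl
  -- the Whittaker character `z ↦ ψ_v(z β′)` as a hom into `ℂˣ`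
  let χq : ∀ (X : skewMatrices ((IsCMField.complexConj L : L ≃ₐ[Fp L] L) : L →+* L) ((gramR L e dV hdV dW hdW).map (algebraMap (Fp L) L)))
      (v : HeightOneSpectrum (𝓞 ↥(maximalRealSubfield L))), Multiplicative (v.adicCompletion ↥(maximalRealSubfield L)) →* ℂˣ :=
    fun X v => Circle.toUnits.comp ((ψ v).mulShift (β' X v)).toMonoidHom
  have hχapply : ∀ X v (z : Multiplicative (v.adicCompletion ↥(maximalRealSubfield L))),
      ((χq X v z : ℂˣ) : ℂ) = ((ψ v (Multiplicative.toAdd z * β' X v) : Circle) : ℂ) := by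
    intro X v z
    have hz : ((χq X v z : ℂˣ) : ℂ) = ((Circle.toUnits ((ψ v).mulShift (β' X v) (Multiplicative.toAdd z)) : ℂˣ) : ℂ) := rfl
    rw [hz, Circle.toUnits_apply, Units.val_mk0, AddChar.mulShift_apply, mul_comm]
  refine hbad_faces_of_lineFunctional L e dV hdV dW hdW S₁ val I Tf W cW ρ (fun X v z => Multiplicative.toAdd z) (fun X v t => ⟨Multiplicative.ofAdd t, rfl⟩)
    (fun X v x => -halfForm (cτ X v) x) (fun X v z => ?_) (fun X v z φ' => ?_) β' χq hχapply Λ (fun X j h i v z φ' => ?_) Φ hWfun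
    (fun X hX0 hdet j h v hv hdead x => ?_)
  · -- `hu`: local constancy of `x ↦ ψ_v(z · Gm x)` (`ψ_v` locally constant, the phase continuous)
    exact (IsLocallyConstant.comp_continuous (hl v) ((continuous_const.mul (continuous_halfForm (cτ X v)).neg))).comp Subtype.val
  · -- `hρ`: Rao's multiplier law
    funext x
    rw [hρapply, Pi.mul_apply, coe_unipOpPi_apply, halfForm_smul_left, mul_neg]
  · -- `hΛ` in the by-value model is the CONCRETE quasi-invariance
    rw [hρapply, hχapply, hΛ]
  · -- `hfibre`: the Ψ-free dichotomy of ★ p863790 at the parameter `−β′`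
    intro hx
    have hx' : halfForm (cτ X v) x = -β' X v := by rw [← neg_neg (halfForm (cτ X v) x), hx]
    exact halfForm_cOfFix_mover_conj_nElem_ne_of_hilbertSymbol_cmQuadraticGenerator L v (hTs v) (τ X v) (hτ X v) (E'' v) (-β' X v)
      (neg_ne_zero.2 (hβ X v)) (hclass X hX0 hdet j h v hv hdead) x hx'

end Row

end Summit.HodgeConjecture.HodgeConjecture.Cruxes.HLiu418.K2LiuIncoherentRankOneBadPlaceLineModel

end
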